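import Mathlib
import Summits.Ventures.PercRepro2.SwOutAll
import Summits.Ventures.PercRepro2.SwOutSeriesDefs
import Summits.Ventures.PercRepro2.SwOutSeriesContract
import Summits.Ventures.PercRepro2.SwOutSeriesContractCount
import Summits.Ventures.PercRepro2.SwOutSeriesDelete
import Summits.Ventures.PercRepro2.SwOutSeriesDeleteCount
import Summits.Ventures.PercRepro2.SwOutSeriesThm
import Summits.Ventures.PercRepro2.SwOutLeaf
import Summits.Ventures.PercRepro2.SwOutLeafThm
import Summits.Ventures.PercRepro2.SwOutLoop
import Summits.Ventures.PercRepro2.SwOutLoopThm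
import Summits.Ventures.PercRepro2.SwOutReducible
import Summits.Ventures.PercRepro2.SwOutArmFlip
import Summits.Ventures.PercRepro2.SwOutArms
import Summits.Ventures.PercRepro2.SwOutArmOrbit
import Summits.Ventures.PercRepro2.SwOutArmCube
import Summits.Ventures.PercRepro2.SwOutArmThm
import Summits.Ventures.PercRepro2.SwOutJunctionSplit
import Summits.Ventures.PercRepro2.SwOutJunctionFine
import Summits.Ventures.PercRepro2.SwOutJunctionRegion
import Summits.Ventures.PercRepro2.SwOutJunction

/-!
# Row (SW) from the junction theorem (blind cell PercRepro2, night-4 g11, 2026-08-25;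
proofs/NIGHT4-G11.md §3)

A region with one junction is a base region of the series reduction (`reducible_of_junction`);
hence row (SW) holds on every graph in which every vertex other than `l, h, o` and ONE vertex `u`
is joined to `l`, where `u` is not joined to `l`, carries no loop, and every neighbour of `u` other
than `h` is joined to `h` (`swAll_of_junction`, **`sw_of_junction`**).  The vertex `u` is a CORE
(a vertex of both clusters of `h`) in part of the class — the first such configurations in the
kernel beyond the cyclic graphs of g10.  Instance: `K₅` minus the edge `lu` (`sw_k5_minus_lu`).
-/

namespace Summit.Ventures.PercRepro2

namespace LocRows

open Hull

variable {V : Type*} {E : Type*} [Fintype E] [DecidableEq E]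

open scoped Classical

variable {ends : E → Sym2 V} {l h o u : V}

/-- A region with one junction is a base region of the series reduction. -/
theorem reducible_of_junction {U : Set V} (hl : l ∉ U) (hloop_h : ∀ e, ends e ≠ s(h, h))
    (hloop_u : ∀ e, ends e ≠ s(u, u)) (hu : u ∈ U) (hhu : h ≠ u)
    (hadj : ∀ e (he : u ∈ ends e), Sym2.Mem.other he ≠ h →
      ∃ e', ends e' = s(Sym2.Mem.other he, h))
    (hout : ∀ x ∈ U, x ≠ h → x ≠ o → x ≠ u →
      (∃ e y, ends e = s(x, y) ∧ y ∉ U) ∨ (∀ e, x ∉ ends e)) :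
    Reducible l h o ends U :=
  Reducible.base ends U fun ξ _ h𝓔 =>
    rigidOK_of_junction (ξ := ξ) hl hloop_h hloop_u hu hhu hadj hout h𝓔

/-- **Row 2′SW-ALL on every graph with one junction**: every vertex other than `l, h, o, u` is
joined to `l`, `u ≠ l`, no loop at `h` or `u`, every neighbour of `u` other than `h` is joined to
`h`. -/
theorem swAll_of_junction (hlh : l ≠ h) (hloop_h : ∀ e, ends e ≠ s(h, h))
    (hloop_u : ∀ e, ends e ≠ s(u, u)) (hul : u ≠ l) (hhu : h ≠ u)
    (hadj : ∀ e (he : u ∈ ends e), Sym2.Mem.other he ≠ h →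
      ∃ e', ends e' = s(Sym2.Mem.other he, h))
    (hjoin : ∀ x, x ≠ l → x ≠ h → x ≠ o → x ≠ u → ∃ e, ends e = s(x, l)) : SwAll ends l h o := by
  refine swAll_of_reducible l h o hlh
    (reducible_of_junction (by simp) hloop_h hloop_u (by simpa using hul) hhu hadj ?_)
  intro x hx hxh hxo hxu
  obtain ⟨e, he⟩ := hjoin x (by simpa using hx) hxh hxo hxu
  exact Or.inl ⟨e, l, he, by simp⟩

/-- **Row (SW) on every graph with one junction** (see `swAll_of_junction`). -/
theorem sw_of_junction (hlh : l ≠ h) (hloop_h : ∀ e, ends e ≠ s(h, h))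
    (hloop_u : ∀ e, ends e ≠ s(u, u)) (hul : u ≠ l) (hhu : h ≠ u)
    (hadj : ∀ e (he : u ∈ ends e), Sym2.Mem.other he ≠ h →
      ∃ e', ends e' = s(Sym2.Mem.other he, h))
    (hjoin : ∀ x, x ≠ l → x ≠ h → x ≠ o → x ≠ u → ∃ e, ends e = s(x, l)) : Sw ends l h o :=
  sw_of_swAll ends (swAll_of_junction hlh hloop_h hloop_u hul hhu hadj hjoin)

/-! ## Instance: `K₅` minus the edge `lu` -/

/-- `K₅` on `Fin 5` without the edge `{0, 2}`: `l = 0`, `u = 2`. -/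
def k5MinusLu : Fin 9 → Sym2 (Fin 5)
  | 0 => s(0, 1) | 1 => s(0, 3) | 2 => s(0, 4) | 3 => s(1, 2) | 4 => s(1, 3) | 5 => s(1, 4)
  | 6 => s(2, 3) | 7 => s(2, 4) | 8 => s(3, 4)

/-- **Row (SW) on `K₅ − lu`** with `l = 0`, `h = 1`, `o = 3` and the junction `u = 2` (not joined
to `l`; its neighbours `3, 4` are joined to `h`): `u` is a core of `h` in part of the class. -/
theorem sw_k5_minus_lu : Sw k5MinusLu 0 1 3 := by
  refine sw_of_junction (l := 0) (h := 1) (o := 3) (u := 2) (by decide) ?_ ?_ (by decide)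
    (by decide) ?_ ?_
  · intro e; fin_cases e <;> decide
  · intro e; fin_cases e <;> decide
  · intro e he hph
    fin_cases e
    · exact absurd he (by decide)
    · exact absurd he (by decide)
    · exact absurd he (by decide)
    · exact absurd hph (by rw [other_eq_of_ends he (p := 1) (by decide) (by decide)]; exact fun h' => h' rfl)
    · exact absurd he (by decide)
    · exact absurd he (by decide)
    · exact ⟨4, by rw [other_eq_of_ends he (p := 3) (by decide) (by decide)]; decide⟩
    · exact ⟨5, by rw [other_eq_of_ends he (p := 4) (by decide) (by decide)]; decide⟩
    · exact absurd he (by decide)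
  · intro x hx0 hx1 hx3 hx2
    fin_cases x
    · exact absurd rfl hx0
    · exact absurd rfl hx1
    · exact absurd rfl hx2
    · exact absurd rfl hx3
    · exact ⟨2, by rw [Sym2.eq_swap]; rfl⟩

/-! ## The infinite family `K_{n+4} − lu` -/

/-- `K_{n+4}` on `Fin (n+4)` without the edge `{0, 2}` (`l = 0`, `u = 2`): the edges are the pairs
`p.1 < p.2` other than `(0, 2)`. -/
def completeMinusEnds (n : ℕ) :
    {p : Fin (n + 4) × Fin (n + 4) // p.1 < p.2 ∧ ¬ (p.1.val = 0 ∧ p.2.val = 2)} →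
      Sym2 (Fin (n + 4)) :=
  fun p => s(p.1.1, p.1.2)

/-- **Row (SW) on every `K_{n+4} − lu`** with `l = 0`, `h = 1`, the junction `u = 2` and every
`o`: the first infinite family with a core at a vertex of degree `≥ 3` not joined to `l` (here of
degree `n + 2`). -/
theorem sw_complete_minus (n : ℕ) (o : Fin (n + 4)) :
    Sw (completeMinusEnds n) ⟨0, by omega⟩ ⟨1, by omega⟩ o := by
  set l : Fin (n + 4) := ⟨0, by omega⟩ with hl
  set h : Fin (n + 4) := ⟨1, by omega⟩ with hh
  set u : Fin (n + 4) := ⟨2, by omega⟩ with hu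
  have hlh : l ≠ h := fun h' => by have := congrArg Fin.val h'; simp [hl, hh] at this
  have hul : u ≠ l := fun h' => by have := congrArg Fin.val h'; simp [hl, hu] at this
  have hhu : h ≠ u := fun h' => by have := congrArg Fin.val h'; simp [hh, hu] at this
  have hnoloop : ∀ (v : Fin (n + 4)) (e : {p : Fin (n + 4) × Fin (n + 4) //
      p.1 < p.2 ∧ ¬ (p.1.val = 0 ∧ p.2.val = 2)}), completeMinusEnds n e ≠ s(v, v) := by
    rintro v ⟨⟨a, b⟩, hab, _⟩ h'
    simp only [completeMinusEnds, Sym2.eq_iff] at h'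
    rcases h' with ⟨rfl, rfl⟩ | ⟨rfl, rfl⟩ <;> exact lt_irrefl _ hab
  have hadj : ∀ e (he : u ∈ completeMinusEnds n e), Sym2.Mem.other he ≠ h →
      ∃ e', completeMinusEnds n e' = s(Sym2.Mem.other he, h) := by
    rintro ⟨⟨a, b⟩, hab, hne⟩ he hph
    simp only [completeMinusEnds, Sym2.mem_iff] at he
    rw [Fin.lt_def] at hab
    rcases he with rfl | rfl
    · -- the edge `(u, b)` with `u < b`: the other end is `b`, joined to `h` by `(h, b)`
      have hb2 : b ≠ u := fun h' => by rw [h'] at hab; exact lt_irrefl _ hab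
      have hoth : Sym2.Mem.other he = b := other_eq_of_ends he rfl hb2
      rw [hoth]
      have h1b : h < b := by rw [Fin.lt_def]; simp only [hh, hu] at hab ⊢; omega
      refine ⟨⟨(h, b), h1b, fun h' => by simp [hh] at h'⟩, ?_⟩
      simp [completeMinusEnds, Sym2.eq_swap]
    · -- the edge `(a, u)` with `a < u`, `a ≠ l`: then `a = h`, excluded by `hph`
      exfalso
      have ha2 : a ≠ u := fun h' => by rw [h'] at hab; exact lt_irrefl _ hab
      have hoth : Sym2.Mem.other he = a :=
        other_eq_of_ends he (by simp [completeMinusEnds, Sym2.eq_swap]) ha2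
      rw [hoth] at hph
      apply hph
      have ha0 : a.val ≠ 0 := fun h0 => hne ⟨h0, rfl⟩
      simp only [hu] at hab
      exact Fin.ext (by simp only [hh]; omega)
  have hjoin : ∀ x, x ≠ l → x ≠ h → x ≠ o → x ≠ u → ∃ e, completeMinusEnds n e = s(x, l) := by
    intro x hx0 _ _ hx2
    have hx0' : x.val ≠ 0 := fun h' => hx0 (Fin.ext h')
    have hx2' : x.val ≠ 2 := fun h' => hx2 (Fin.ext h')
    have h0x : l < x := by rw [Fin.lt_def]; simp only [hl]; omega
    refine ⟨⟨(l, x), h0x, fun h' => hx2' h'.2⟩, ?_⟩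
    simp [completeMinusEnds, Sym2.eq_swap]
  exact sw_of_junction hlh (hnoloop h) (hnoloop u) hul hhu hadj hjoin

end LocRows

end Summit.Ventures.PercRepro2
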